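import Summits.CriticalPhenomena.PercolationContinuityZ3.Theorems.PercNearOneGluingNoHeavyLowerTailSahiTangentCylinderPairsTwoWeights

/-!
# `NoHeavyLowerTail` (crux stmt-CriticalPhenomena-4575), Sahi programme: the all-orders contraction inequality for cylinders IN NATIVE PERCOLATION FORM —
# one cube `{0,1}^ι`, one product measure, one distinguished coordinate `e`:
# `p_e · E_n(1_{C(t_0)},…,1_{C(t_{n−1})}) ≤ E_n(1_{C(t_0 ∪ {e}) ∪ C(b_0)},…,1_{C(t_{n−1} ∪ {e}) ∪ C(b_{n−1})})`  (`t_l ⊆ b_l ∌ e`)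

Support file (Sahi cell, seat `prim-sahi-p1`, generation 50; `--supports stmt-CriticalPhenomena-4575`).  Pure proofs, NO definitions, no `sorry`,
standard axioms.

THE RESULTS.  `μ = bernoulliWeight q` on `Set ι` (coordinate `i` open with probability `q_i`), `C(σ) = {ω | σ ⊆ ω}` ("all of `σ` open").
* `sahiE_cylinderPairs_edge_ge`: for `t_l ⊆ b_l`, `e ∉ b_l`, the events `A_l = C(t_l ∪ {e}) ∪ C(b_l)` ("`t_l` open, and `e` open or all of `b_l` open")
  satisfy, at EVERY order `n`,  `q_e · E_n(1_{C(t_l)}) ≤ E_n(1_{A_l})` — i.e. `E_n(A_0,…,A_{n−1}) ≥ P(e open) · E_n(A_0,…,A_{n−1} | e open)`, since given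
  `e` open `A_l = C(t_l)`.
* `sahiE_cylinders_edge_ge`: for cylinders `σ_l ∌ e` and any set `L` of slots,  `q_e · E_n(1_{C(σ_l)}) ≤ E_n(1_{C(σ_l ∪ {e}·[l ∈ L])})` — adding a common
  fresh coordinate to some of the cylinders costs at most the factor `q_e` (Theorem V, gen 49, read on one cube).
Both are TRANSPORTS (`sahiE_congr_of_moments`: `E_n` depends on the slots only through their mixed moments) of the two-layer theorems on
`Bool × Set ι` (`sahiE_coin_cylinders_ge`, this generation; `vtxD_nonneg`, gen 49): with `s = q_e`, `μ(C(T ∪ {e}) ∪ C(B)) = q_e M(T) + (1 − q_e) M(B)`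
for `T ⊆ B ∌ e` is exactly the mixed moment of the pair slots under `B_s ⊗ μ`.  (The coordinate `e` of the cube is simply ignored by the tops.)
Nothing conjectural is asserted. [this work]
-/

namespace Summit.CriticalPhenomena.PercolationContinuityZ3.Theorems.SahiTangentCyl

open Finset Function Literature.Combinatorics.Sahi2008
open Literature.Probability.Percolation.DecisionTree (ind ind_of_mem ind_of_not_mem ind_nonneg)
open scoped BigOperators

noncomputable section

variable {ι : Type*} [DecidableEq ι]

/-! ### The pair events on one cube and their intersections -/

/-- Intersections of pair events `C(T ∪ {e}) ∪ C(B)` (`T ⊆ B`): tops and bottoms unite. [this work] -/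
theorem pairEvent_inter {T₁ B₁ T₂ B₂ : Finset ι} (h₁ : T₁ ⊆ B₁) (h₂ : T₂ ⊆ B₂) (e : ι) :
    ({ω : Set ι | ((insert e T₁ : Finset ι) : Set ι) ⊆ ω} ∪ {ω : Set ι | (B₁ : Set ι) ⊆ ω})
        ∩ ({ω : Set ι | ((insert e T₂ : Finset ι) : Set ι) ⊆ ω} ∪ {ω : Set ι | (B₂ : Set ι) ⊆ ω})
      = {ω : Set ι | ((insert e (T₁ ∪ T₂) : Finset ι) : Set ι) ⊆ ω} ∪ {ω : Set ι | ((B₁ ∪ B₂ : Finset ι) : Set ι) ⊆ ω} := by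
  have h₁' : (T₁ : Set ι) ⊆ B₁ := coe_subset.2 h₁
  have h₂' : (T₂ : Set ι) ⊆ B₂ := coe_subset.2 h₂
  ext ω
  simp only [Set.mem_inter_iff, Set.mem_union, Set.mem_setOf_eq, coe_insert, coe_union, Set.insert_subset_iff, Set.union_subset_iff]
  constructor
  · rintro ⟨⟨he, hT₁⟩ | hB₁, ⟨_, hT₂⟩ | hB₂⟩
    · exact Or.inl ⟨he, hT₁, hT₂⟩
    · exact Or.inl ⟨he, hT₁, h₂'.trans hB₂⟩
    · rename_i he
      exact Or.inl ⟨he, h₁'.trans hB₁, hT₂⟩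
    · exact Or.inr ⟨hB₁, hB₂⟩
  · rintro (⟨he, hT₁, hT₂⟩ | ⟨hB₁, hB₂⟩)
    · exact ⟨Or.inl ⟨he, hT₁⟩, Or.inl ⟨he, hT₂⟩⟩
    · exact ⟨Or.inr hB₁, Or.inr hB₂⟩

/-- Products of pair-event indicators over a finset of slots. [this work] -/
theorem prod_pairInd {n : ℕ} {t b : Fin n → Finset ι} (htb : ∀ l, t l ⊆ b l) (e : ι) (S : Finset (Fin n)) :
    ∏ l ∈ S, (fun ω : Set ι => ind ({ω : Set ι | ((insert e (t l) : Finset ι) : Set ι) ⊆ ω} ∪ {ω : Set ι | (b l : Set ι) ⊆ ω}) ω)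
      = fun ω => ind ({ω : Set ι | ((insert e (S.biUnion t) : Finset ι) : Set ι) ⊆ ω} ∪ {ω : Set ι | ((S.biUnion b : Finset ι) : Set ι) ⊆ ω}) ω := by
  induction S using Finset.induction_on with
  | empty =>
    funext ω
    simp only [Finset.prod_empty, Finset.biUnion_empty, Pi.one_apply]
    exact (ind_of_mem (Or.inr (by simp))).symm
  | insert a s ha ih =>
    rw [Finset.prod_insert ha, ih]
    funext ω
    rw [Pi.mul_apply, ← Literature.Probability.Percolation.BHK2006.ind_inter, pairEvent_inter (htb a) (Finset.biUnion_mono fun l _ => htb l), Finset.biUnion_insert,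
      Finset.biUnion_insert]

omit [DecidableEq ι] in
/-- Inclusion–exclusion for indicators: `1_{A ∪ B} = 1_A + 1_B − 1_{A ∩ B}`. [folklore] -/
theorem ind_union_apply (A B : Set (Set ι)) (ω : Set ι) : ind (A ∪ B) ω = ind A ω + ind B ω - ind (A ∩ B) ω := by
  by_cases hA : ω ∈ A <;> by_cases hB : ω ∈ B <;> simp [ind_of_mem, ind_of_not_mem, hA, hB]

/-- Two cylinders intersect in the cylinder of the union. [folklore] -/
theorem cyl_inter_cyl (X Y : Finset ι) :
    {ω : Set ι | (X : Set ι) ⊆ ω} ∩ {ω : Set ι | (Y : Set ι) ⊆ ω} = {ω : Set ι | ((X ∪ Y : Finset ι) : Set ι) ⊆ ω} := by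
  ext ω; simp [Set.union_subset_iff]

/-- Adding a fresh coordinate multiplies the mass of a cylinder by its probability. [this work] -/
theorem cylMass_insert (p : ι → ℝ) {e : ι} {X : Finset ι} (he : e ∉ X) : cylMass p (insert e X) = p e * cylMass p X := by
  unfold cylMass; rw [Finset.prod_insert he]

variable [Fintype ι]

omit [DecidableEq ι] in
/-- `E` of a three-term combination (plumbing). [folklore] -/
theorem ex_add_sub (μ f g h : Set ι → ℝ) : ex μ (fun ω => f ω + g ω - h ω) = ex μ f + ex μ g - ex μ h := by
  simp only [ex, mul_add, mul_sub, Finset.sum_add_distrib, Finset.sum_sub_distrib]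

/-- **Mass of a pair event**: `μ(C(T ∪ {e}) ∪ C(B)) = q_e·M(T) + (1 − q_e)·M(B)` for `T ⊆ B ∌ e`. [this work] -/
theorem ex_pairInd (q : ι → unitInterval) {T B : Finset ι} (hTB : T ⊆ B) {e : ι} (he : e ∉ B) :
    ex (bernoulliWeight q) (fun ω : Set ι => ind ({ω : Set ι | ((insert e T : Finset ι) : Set ι) ⊆ ω} ∪ {ω : Set ι | (B : Set ι) ⊆ ω}) ω)
      = (q e : ℝ) * cylMass (fun i => (q i : ℝ)) T + (1 - q e) * cylMass (fun i => (q i : ℝ)) B := by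
  have heT : e ∉ T := fun h => he (hTB h)
  simp only [ind_union_apply, cyl_inter_cyl]
  rw [ex_add_sub, ex_ind_cyl', ex_ind_cyl', ex_ind_cyl']
  have hu : insert e T ∪ B = insert e B := by
    rw [Finset.insert_union, Finset.union_eq_right.2 hTB]
  rw [hu, cylMass_insert _ heT, cylMass_insert _ he]
  ring

/-- **THE CONTRACTION INEQUALITY FOR CYLINDER PAIRS, NATIVE FORM, EVERY ORDER.**  `μ = bernoulliWeight q` on `Set ι`; `t_l ⊆ b_l`, `e ∉ b_l`;
`A_l = C(t_l ∪ {e}) ∪ C(b_l)`.  Then `q_e · E_n(1_{C(t_0)},…,1_{C(t_{n−1})}) ≤ E_n(1_{A_0},…,1_{A_{n−1}})` — `E_n(A) ≥ P(e open)·E_n(A | e open)`.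
Transport of `sahiE_coin_cylinders_ge` along equal mixed moments. [this work] -/
theorem sahiE_cylinderPairs_edge_ge (q : ι → unitInterval) {n : ℕ} {t b : Fin n → Finset ι} (htb : ∀ l, t l ⊆ b l) {e : ι}
    (he : ∀ l, e ∉ b l) :
    (q e : ℝ) * sahiE (bernoulliWeight q) n (fun l (ω : Set ι) => ind {ω : Set ι | (t l : Set ι) ⊆ ω} ω) ≤
      sahiE (bernoulliWeight q) n
        (fun l (ω : Set ι) => ind ({ω : Set ι | ((insert e (t l) : Finset ι) : Set ι) ⊆ ω} ∪ {ω : Set ι | (b l : Set ι) ⊆ ω}) ω) := by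
  have hs0 : 0 ≤ (q e : ℝ) := (q e).2.1
  have hs1 : (q e : ℝ) ≤ 1 := (q e).2.2
  have main := sahiE_coin_cSlot_pairs_ge q hs0 hs1 n t b htb
  have etr : sahiE (fun z : Bool × Set ι => if z.1 then (q e : ℝ) * bernoulliWeight q z.2 else (1 - (q e : ℝ)) * bernoulliWeight q z.2) n
        (fun l => cSlot (t l) (b l) 1)
      = sahiE (bernoulliWeight q) n
        (fun l (ω : Set ι) => ind ({ω : Set ι | ((insert e (t l) : Finset ι) : Set ι) ⊆ ω} ∪ {ω : Set ι | (b l : Set ι) ⊆ ω}) ω) := by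
    refine sahiE_congr_of_moments _ _ n _ _ fun S _ => ?_
    have p1 := prod_cSlot t b (fun _ => (1 : ℝ)) S
    simp only [Finset.prod_const_one] at p1
    rw [p1, ex_cSlot, prod_pairInd htb e S,
      ex_pairInd q (Finset.biUnion_subset.2 fun l hl => (htb l).trans (Finset.subset_biUnion_of_mem b hl)) (by simpa using fun l _ => he l)]
    ring
  rw [etr] at main
  exact main

/-- **Sahi positivity for cylinder-pair events, every order** (a proved case of Sahi's / Kahn's positivity outside the cumulation cone: the Möbius
transform of `1_{C(t ∪ {e}) ∪ C(b)} = 1_{C(t∪{e})} + 1_{C(b)} − 1_{C(b∪{e})}` has a negative entry).  `t_l ⊆ b_l ∌ e`: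
`0 ≤ E_n(1_{C(t_0 ∪ {e}) ∪ C(b_0)},…,1_{C(t_{n−1} ∪ {e}) ∪ C(b_{n−1})})` under every product measure. [this work] -/
theorem sahiE_cylinderPairs_edge_nonneg (q : ι → unitInterval) {n : ℕ} {t b : Fin n → Finset ι} (htb : ∀ l, t l ⊆ b l) {e : ι}
    (he : ∀ l, e ∉ b l) :
    0 ≤ sahiE (bernoulliWeight q) n
        (fun l (ω : Set ι) => ind ({ω : Set ι | ((insert e (t l) : Finset ι) : Set ι) ⊆ ω} ∪ {ω : Set ι | (b l : Set ι) ⊆ ω}) ω) :=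
  le_trans (mul_nonneg (q e).2.1 (sahiE_cyl_nonneg q t)) (sahiE_cylinderPairs_edge_ge q htb he)

/-- **ADDING A COMMON FRESH COORDINATE TO SOME CYLINDERS COSTS AT MOST ITS PROBABILITY** (Theorem V on one cube).  `σ_l ∌ e`, `L` any set of slots
(`c l = true`):  `q_e · E_n(1_{C(σ_l)}) ≤ E_n(1_{C(σ_l ∪ {e}·[l ∈ L])})`. [this work] -/
theorem sahiE_cylinders_edge_ge (q : ι → unitInterval) {n : ℕ} (c : Fin n → Bool) {σ : Fin n → Finset ι} {e : ι} (he : ∀ l, e ∉ σ l) :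
    (q e : ℝ) * sahiE (bernoulliWeight q) n (fun l (ω : Set ι) => ind {ω : Set ι | (σ l : Set ι) ⊆ ω} ω) ≤
      sahiE (bernoulliWeight q) n
        (fun l (ω : Set ι) => ind {ω : Set ι | ((if c l then insert e (σ l) else σ l : Finset ι) : Set ι) ⊆ ω} ω) := by
  have hs0 : 0 ≤ (q e : ℝ) := (q e).2.1
  have hs1 : (q e : ℝ) ≤ 1 := (q e).2.2
  have main := vtxD_nonneg q hs0 hs1 c σ
  unfold vtxD at main
  -- the vertex family has the same mixed moments as the one-cube family
  have etr : sahiE (fun z : Bool × Set ι => if z.1 then (q e : ℝ) * bernoulliWeight q z.2 else (1 - (q e : ℝ)) * bernoulliWeight q z.2) n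
        (fun l => vtxSlot (c l) (σ l))
      = sahiE (bernoulliWeight q) n
        (fun l (ω : Set ι) => ind {ω : Set ι | ((if c l then insert e (σ l) else σ l : Finset ι) : Set ι) ⊆ ω} ω) := by
    refine sahiE_congr_of_moments _ _ n _ _ fun S _ => ?_
    -- write the vertex slots as coin-cylinder slots `cSlot σ σ κ`, `κ = 0/1`
    have ev : (fun l => vtxSlot (c l) (σ l)) = fun l => cSlot (σ l) (σ l) (if c l then 0 else 1) := by
      funext l
      cases c l
      · simp [cSlot_self_one]
      · simp [cSlot_zero]
    rw [ev, prod_cSlot, ex_cSlot, prod_cylInd, ex_ind_cyl']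
    by_cases hL : ∃ l ∈ S, c l = true
    · obtain ⟨l₀, hl₀, hc⟩ := hL
      have hz : ∏ l ∈ S, (if c l then (0 : ℝ) else 1) = 0 := Finset.prod_eq_zero hl₀ (by simp [hc])
      have hU : S.biUnion (fun l => if c l then insert e (σ l) else σ l) = insert e (S.biUnion σ) := by
        ext x
        simp only [mem_biUnion, mem_insert]
        constructor
        · rintro ⟨l, hl, hx⟩
          by_cases h : c l = true
          · rw [if_pos h, mem_insert] at hx
            rcases hx with rfl | hx
            · exact Or.inl rfl
            · exact Or.inr ⟨l, hl, hx⟩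
          · rw [if_neg h] at hx; exact Or.inr ⟨l, hl, hx⟩
        · rintro (rfl | ⟨l, hl, hx⟩)
          · exact ⟨l₀, hl₀, by rw [if_pos hc]; exact mem_insert_self _ _⟩
          · refine ⟨l, hl, ?_⟩
            by_cases h : c l = true
            · rw [if_pos h]; exact mem_insert_of_mem hx
            · rw [if_neg h]; exact hx
      have heS : e ∉ S.biUnion σ := by simpa using fun l _ => he l
      rw [hz, hU, cylMass_insert _ heS]
      ring
    · push Not at hL
      have h1 : ∏ l ∈ S, (if c l then (0 : ℝ) else 1) = 1 := Finset.prod_eq_one fun l hl => by simp [hL l hl]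
      have hU : S.biUnion (fun l => if c l then insert e (σ l) else σ l) = S.biUnion σ :=
        Finset.biUnion_congr rfl fun l hl => by simp [hL l hl]
      rw [h1, hU]
      ring
  rw [etr] at main
  linarith

end

end Summit.CriticalPhenomena.PercolationContinuityZ3.Theorems.SahiTangentCyl
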